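import Summits.ValiantsHypothesis.ValiantsHypothesis.Theorems.NewtonUnitEquationsTwoProductsMomentRecordDefs

/-!
# R12 glue (A0) ⇒ (A): `LayerRecordLaw → MomentRecordLaw`

The typed S-sized target `momentRecord_of_layerRecord` of `…MomentRecordDefs` (crit-8 g2 W3 rev 2, l.150), proved:
a record `(S, k)` is a layer-`k` top for the same weight (a competitor `S'` with `F_k(S') ≠ 0` has `k ≤ |S'|` because
`deg M(S') ≤ |S'|`, so `(S', k)` is live; same-layer competitors share the shift `k • d`, which the linear weight `wtZ` cancels),
and there are `m + 1 ≤ 2^m` layers, so the constants `(a, b)` of (A0) give `(a + 1, b)` for (A).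
Helper on crux `stmt-ValiantsHypothesis-5906` (line `relation_ladder`); it does NOT prove (A0), (A), the rung (B), or the crux.  VP ≠ VNP is NOT proved.
-/

set_option linter.dupNamespace false

noncomputable section

open Classical

namespace Summit.ValiantsHypothesis.ValiantsHypothesis.Theorems.NewtonUnitEquations.TwoProducts.MomentRecord
open scoped BigOperators
open Summit.ValiantsHypothesis.ValiantsHypothesis.Theorems.NewtonUnitEquations.TwoProducts.FormalLogLinearisation
open Summit.ValiantsHypothesis.ValiantsHypothesis.Theorems.NewtonUnitEquations.TwoProducts.PlanarCell
open Polynomial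

variable {m n : ℕ}

/-- Each binomial `α + z β` has degree at most one. -/
theorem natDegree_C_add_X_mul_C_le (a b : ℂ) : (C a + X * C b).natDegree ≤ 1 := by
  calc (C a + X * C b).natDegree ≤ max (C a).natDegree (X * C b).natDegree := natDegree_add_le _ _
    _ ≤ 1 := by
      refine max_le (by simp) ?_
      exact (natDegree_mul_C_le _ _).trans natDegree_X_le

/-- The moment polynomial of `S` has degree at most `|S|`. -/
theorem natDegree_momentPoly_le (α β : Fin m → Fin n → ℂ) (S : Fin n → ℕ) :
    (momentPoly α β S).natDegree ≤ size S := by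
  unfold momentPoly size
  refine natDegree_sum_le_of_forall_le _ _ fun j _ => ?_
  refine (natDegree_prod_le _ _).trans (Finset.sum_le_sum fun i _ => ?_)
  refine (natDegree_pow_le).trans ?_
  simpa using Nat.mul_le_mul_left (S i) (natDegree_C_add_X_mul_C_le (α j i) (β j i))

/-- Layers above the size vanish: `F_k(S) = 0` for `|S| < k`. -/
theorem layer_eq_zero_of_size_lt (α β α' β' : Fin m → Fin n → ℂ) {k : ℕ} {S : Fin n → ℕ} (h : size S < k) :
    layer α β α' β' k S = 0 := by
  unfold layer
  rw [coeff_sub, coeff_eq_zero_of_natDegree_lt ((natDegree_momentPoly_le α β S).trans_lt h),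
    coeff_eq_zero_of_natDegree_lt ((natDegree_momentPoly_le α' β' S).trans_lt h), sub_zero]

/-- A nonzero layer index is at most the size. -/
theorem le_size_of_layer_ne_zero (α β α' β' : Fin m → Fin n → ℂ) {k : ℕ} {S : Fin n → ℕ}
    (h : layer α β α' β' k S ≠ 0) : k ≤ size S := by
  by_contra hk
  exact h (layer_eq_zero_of_size_lt α β α' β' (not_le.mp hk))

/-- The weight of the point of `(S, k)` splits as carrier weight plus `k` times the weight of the shift. -/
theorem wtZ_ptZ_eq (ξ : Fin 2 → ℝ) (x : Fin n → Expo) (d : Fin 2 → ℤ) (S : Fin n → ℕ) (k : ℕ) :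
    wtZ ξ (ptZ x d S k) = wtZ ξ (ptZ x 0 S 0) + (k : ℝ) * wtZ ξ d := by
  simp only [wtZ, ptZ, Pi.zero_apply, mul_zero, add_zero, Int.cast_add, Int.cast_mul, Int.cast_natCast]
  ring

/-- A record `(S, k)` is a layer-`k` top for the same weight. -/
theorem isLayerTop_of_isRecord (α β α' β' : Fin m → Fin n → ℂ) (x : Fin n → Expo) (d : Fin 2 → ℤ) (m' : ℕ)
    (ξ : Fin 2 → ℝ) (p : (Fin n → ℕ) × ℕ) (hp : IsRecord α β α' β' x d m' ξ p) :
    IsLayerTop α β α' β' x m' p.2 ξ p.1 := by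
  obtain ⟨⟨hsz, _, hne⟩, hmax⟩ := hp
  refine ⟨hsz, hne, fun S' hS' hS'ne hlay => ?_⟩
  have hlive : (S', p.2) ∈ live α β α' β' m' :=
    ⟨hS', le_size_of_layer_ne_zero α β α' β' hlay, hlay⟩
  have hq : (S', p.2) ≠ p := by
    intro h; exact hS'ne (by rw [← h])
  have hlt := hmax _ hlive hq
  rw [wtZ_ptZ_eq ξ x d S', wtZ_ptZ_eq ξ x d p.1] at hlt
  linarith

/-- **(A0) ⇒ (A)**: the layer record law implies the moment record law (constants `(a, b) ↦ (a + 1, b)`). -/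
theorem momentRecord_of_layerRecord_holds : momentRecord_of_layerRecord := by
  unfold momentRecord_of_layerRecord LayerRecordLaw MomentRecordLaw
  rintro ⟨a, b, h⟩
  refine ⟨a + 1, b, fun m n t α β α' β' x d ht hs hs' hn hcd => ?_⟩
  set Rec := (shallowPairs n m).filter fun p => ∃ ξ : Fin 2 → ℝ, NegWeight x d ξ ∧ IsRecord α β α' β' x d m ξ p
    with hRec
  set Top : ℕ → Finset (Fin n → ℕ) := fun k =>
    (shallowSets n m).filter fun S => ∃ ξ : Fin 2 → ℝ, NegWeight x d ξ ∧ IsLayerTop α β α' β' x m k ξ S with hTop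
  have hsub : Rec ⊆ (Finset.range (m + 1)).biUnion fun k => (Top k).image fun S => (S, k) := by
    intro p hp
    rw [hRec, Finset.mem_filter] at hp
    obtain ⟨hbox, ξ, hneg, hrec⟩ := hp
    rw [shallowPairs, Finset.mem_product] at hbox
    rw [Finset.mem_biUnion]
    refine ⟨p.2, hbox.2, ?_⟩
    rw [Finset.mem_image]
    refine ⟨p.1, ?_, rfl⟩
    rw [hTop, Finset.mem_filter]
    exact ⟨hbox.1, ξ, hneg, isLayerTop_of_isRecord α β α' β' x d m ξ p hrec⟩
  have hTopk : ∀ k ∈ Finset.range (m + 1), ((Top k).image fun S => (S, k)).card ≤ 2 ^ (a * m) * (t + 2) ^ b := by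
    intro k hk
    refine Finset.card_image_le.trans ?_
    exact h m n t k α β α' β' x d ht hs hs' hn (Nat.lt_succ_iff.mp (Finset.mem_range.mp hk)) hcd
  have hm : m + 1 ≤ 2 ^ m := Nat.lt_two_pow_self
  calc Rec.card ≤ ((Finset.range (m + 1)).biUnion fun k => (Top k).image fun S => (S, k)).card :=
        Finset.card_le_card hsub
    _ ≤ ∑ k ∈ Finset.range (m + 1), ((Top k).image fun S => (S, k)).card := Finset.card_biUnion_le
    _ ≤ ∑ _k ∈ Finset.range (m + 1), 2 ^ (a * m) * (t + 2) ^ b := Finset.sum_le_sum hTopk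
    _ = (m + 1) * (2 ^ (a * m) * (t + 2) ^ b) := by simp
    _ ≤ 2 ^ m * (2 ^ (a * m) * (t + 2) ^ b) := Nat.mul_le_mul_right _ hm
    _ = 2 ^ ((a + 1) * m) * (t + 2) ^ b := by ring

end Summit.ValiantsHypothesis.ValiantsHypothesis.Theorems.NewtonUnitEquations.TwoProducts.MomentRecord

end
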